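import Summits.AtomisticToContinuum.Crystallization.Theorems.FreeSplittingCertificatesStrictSplittingRuleTorusModel552CovB

/-!
# The joint (r6) sitewise LMI on the hcp torus 5×5×2 at EVERY site (covariance of the generic Lean model, checked in Lean)

Route `FreeSplittingCertificates`, crux `StrictSplittingRule` (stmt-AtomisticToContinuum-12560); unit b2b-freesplit-B (block 2b,
PART B, gen 1).  **VALUE = theorem about a FINITE model — NOT summit progress**; `stub_coreJointCoercive` is not proved.

Transport of `jointLMI552A/B` to every site of the 5×5×2 torus from the covariance checks `cov5A_check` / `cov5B_check`
(`…TorusModel552CovA/CovB.lean`), `cover5_check`, `norm5_perm_check`, `sumF5_perm_check`: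
`jointLMI552_allSites : ∀ (p : SiteG 4 5) (u : Fin 300 → ℚ), demand5 p u + margin552 · normSqG5 u ≤ supply5 p u + transfer5 p u + meanProj5 u`
(+ zero-mean form).  COMPUTATIONAL regime (`native_decide`, `Lean.ofReduceBool`). [folklore]
-/

namespace Summit.AtomisticToContinuum.Crystallization.Theorems.StrictSplittingRuleTorusLMI

open Literature.Computation.Certificates

/-- Every site of the 5×5×2 torus is an even-layer translate of the reference site of its parity.  COMPUTATIONAL. -/
theorem cover5_check : ∀ p : SiteG 4 5, ∃ g ∈ evenShifts5, p = taddG 4 5 (if parityG 4 5 p then siteA5 else siteB5) g := by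
  native_decide

/-- The norm terms are permuted by a translation.  COMPUTATIONAL. -/
theorem norm5_perm_check : ∀ g ∈ evenShifts5, ((normTermsG 4 5).map (shiftTermN (shiftIdx5 g))).Perm (normTermsG 4 5) := by
  native_decide

/-- The component-sum functionals are permuted by a translation.  COMPUTATIONAL. -/
theorem sumF5_perm_check : ∀ g ∈ evenShifts5, ∀ c : Fin 3, (LinF.relabelN (shiftIdx5 g) (sumFG 4 5 c)).Perm (sumFG 4 5 c) := by
  native_decide

/-! ## Transport to every site -/

/-- `‖u ∘ σ_g‖²_G = ‖u‖²_G`. [folklore] -/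
theorem normSqG5_shift {g : Off} (hg : g ∈ evenShifts5) (u : Fin (dimG 4 5) → ℚ) : normSqG5 (u ∘ shiftIdx5 g) = normSqG5 u := by
  unfold normSqG5
  rw [← evalQ_mapShiftN, evalQ_permN (norm5_perm_check g hg)]

/-- `meanProj5 (u ∘ σ_g) = meanProj5 u`. [folklore] -/
theorem meanProj5_shift {g : Off} (hg : g ∈ evenShifts5) (u : Fin (dimG 4 5) → ℚ) : meanProj5 (u ∘ shiftIdx5 g) = meanProj5 u := by
  have h : ∀ c : Fin 3, LinF.eval (sumFG 4 5 c) (u ∘ shiftIdx5 g) = LinF.eval (sumFG 4 5 c) u := fun c => by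
    rw [← LinF.eval_relabelN, LinF.eval_permN (sumF5_perm_check g hg c)]
  simp only [meanProj5, projTermsG, sqN, evalQ_cons, evalQ_nil, h]

/-- The forms at a translate are the reference forms at the translated field. [folklore] -/
theorem forms5_shift {p r : SiteG 4 5} {g : Off}
    (hcov : siteTermLists5 p = (siteTermLists5 r).map fun ts => ts.map (shiftTermN (shiftIdx5 g))) (u : Fin (dimG 4 5) → ℚ) :
    supply5 p u = supply5 r (u ∘ shiftIdx5 g) ∧ transfer5 p u = transfer5 r (u ∘ shiftIdx5 g) ∧
      demand5 p u = demand5 r (u ∘ shiftIdx5 g) := by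
  simp only [siteTermLists5, List.map_cons, List.map_nil, List.cons.injEq, and_true] at hcov
  obtain ⟨h1, h2, h3, h4⟩ := hcov
  refine ⟨?_, ?_, ?_⟩
  · unfold supply5; rw [h1, evalQ_mapShiftN]
  · unfold transfer5; rw [h2, evalQ_mapShiftN]
  · unfold demand5; rw [h3, h4, evalQ_mapShiftN, evalQ_mapShiftN]

/-- **The joint (r6) sitewise LMI at EVERY site of the 5×5×2 hcp torus** (margin `m = 17171/2²⁰`). Finite model of H12⋆; not the stub. -/
theorem jointLMI552_allSites (p : SiteG 4 5) (u : Fin (dimG 4 5) → ℚ) :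
    demand5 p u + margin552 * normSqG5 u ≤ supply5 p u + transfer5 p u + meanProj5 u := by
  obtain ⟨g, hg, hp⟩ := cover5_check p
  cases hpar : parityG 4 5 p
  · rw [hpar] at hp; simp only [Bool.false_eq_true, ↓reduceIte] at hp
    have hcov := cov5B_check g hg
    rw [← hp] at hcov
    obtain ⟨hs, ht, hd⟩ := forms5_shift hcov u
    have h := jointLMI552B (u ∘ shiftIdx5 g)
    rw [normSqG5_shift hg, meanProj5_shift hg, ← hs, ← ht, ← hd] at h
    exact h
  · rw [hpar] at hp; simp only [↓reduceIte] at hp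
    have hcov := cov5A_check g hg
    rw [← hp] at hcov
    obtain ⟨hs, ht, hd⟩ := forms5_shift hcov u
    have h := jointLMI552A (u ∘ shiftIdx5 g)
    rw [normSqG5_shift hg, meanProj5_shift hg, ← hs, ← ht, ← hd] at h
    exact h

/-- **Zero-mean form at every site (5×5×2).** -/
theorem jointLMI552_allSites_zeroMean (p : SiteG 4 5) (u : Fin (dimG 4 5) → ℚ) (h0 : ∀ c : Fin 3, (sumFG 4 5 c).eval u = 0) :
    demand5 p u + margin552 * normSqG5 u ≤ supply5 p u + transfer5 p u := by
  have h := jointLMI552_allSites p u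
  rw [meanProj5_eq_zero h0, add_zero] at h
  exact h

end Summit.AtomisticToContinuum.Crystallization.Theorems.StrictSplittingRuleTorusLMI
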